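import Mathlib
import Summits.KontsevichZagierPeriods.Zeta5Search.BrickPropositionHTwoSharpDepth
import Summits.KontsevichZagierPeriods.Zeta5Search.BrickDenominatorsOddC

/-!
# BrickDenominatorsOddCTwo — the prime `2`, and KRATTENTHALER–RIVOAL'S THÉORÈME 1 (ii) for `r = 1`, `A` even, ODD `C`, EXACTLY AS
PRINTED, at every prime: `2·d_n^{A+C−1}·p_{0,C,n}((−1)^A) ∈ ℤ` (cell `pub-zeta5`, seat ct-1 g45)

HONEST FRAMING: systematic search; no irrationality claim unless certified.  INTEGRALITY of the rational constant terms
`p_{0,C,n}(1)` of the `C`-fold differentiated very-well-poised brick linear forms `Σ_{k≥1}(1/C!)R_n^{(C)}(k)`,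
`R_n(t) = n!^{A−2B}(t + n/2)(t−n)_n^B(t+n+1)_n^B/(t)_{n+1}^A` — Krattenthaler–Rivoal, *Hypergéométrie et fonction zêta de Riemann*,
Mem. AMS **186** (2007) no. 875, §3 Théorème 1 (ii) («les coefficients `2d_n^{A+C−1}p_{0,C,n}((−1)^A)` sont des nombres entiers»;
arXiv:math/0311114 p. 8), a theorem in print since 2007, reproduced here for `r = 1`, `A` even, `1 ≤ B`, `2B ≤ A`, `C` ODD, by a
DIFFERENT ROUTE (digit induction): `2·p_{0,C,n}(1) = −Σ_m[T^{A+C}]F_m` (`BrickTwistedConstantTerm`); at odd `p` PROPOSITION H^∞ at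
depth `A + C` (`BrickDenominatorsOddC`); at `2` (this file) the centre split `[T^{d}]F_m = [T^{d−1}]F̃_m + (n/2 − m)[T^d]F̃_m` and
the SHARP Proposition H at the odd depth `d = A + C` (`BrickPropositionHTwoSharpDepth`).  WHAT THIS IS NOT: EVEN `C ≥ 2` untouched;
`C = 0` is `BrickDenominatorsTwo.theoreme1_r_one` (ct-1 g44); the named fact `KrattenthalerRivoal2007.theoreme1` (all `A ≥ 2`,
`C ≥ 0`, `r ≥ 0`) is NOT discharged — only its body at `r = 1`, `A` even, `C` odd (and `C = 0`) is proved; nothing about the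
arithmetic nature of `ζ(5)`/`ζ(3)`; no `γ` / `μ` / denominator-law / record statement; records in print UNMOVED.  Theorems only.

* `sum_laurent_one_eq` — `Σ_K[T^{e+1}]F_K = Σ_K[T^e]F̃_K + ½Σ_K(n−2K)[T^{e+1}]F̃_K` (the centre factor, pole by pole);
* `level_two_sum_laurent` — `v₂(2^{ℓe}·Σ_K[T^{e+1}]F_K(n)) ≤ 1` for `n < 2^{ℓ+1}`, `e + 1` odd;
* **`padicValuation_lcmUpto_pow_mul_sum_laurent_two_le`** — `v₂(d_n^{d−1}·Σ_K[T^d]F_K(n)) ≤ 1` for every odd `d`;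
* **`lcmUpto_pow_mul_sum_laurent_isInt`** — `d_n^{d−1}·Σ_{K≤n}[T^d]F_K(n) ∈ ℤ` for every odd `d` (all primes: with
  `BrickPropositionHDepth`); at `d = A − l` this is KR's clause (i), at `d = A + C` their clause (ii) for odd `C`;
* `theoreme1_ii_two` — `v₂(2·d_n^{A+C−1}·p_{0,C,n}((−1)^A)) ≤ 1`, `C` odd;
* **`theoreme1_ii_odd_C`** — `2·d_n^{A+C−1}·p_{0,C,n}((−1)^A) ∈ ℤ` for `A` even, `1 ≤ B`, `2B ≤ A`, `C` odd, every `n`, all data `c`;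
* **`theoreme1_r_one_odd_C`** — clauses (i) (ct-1 g44, `C`-free) and (ii) together: the body of `KrattenthalerRivoal2007.theoreme1`
  at `r = 1` under `Even A`, `Odd C` (with `2B ≤ A` for `2B·r < A`).
DATA (seat desk `alg/laurent.py`, `alg/two.py`, exact, not used by the kernel): `ord₂(d_n^{d−1}Σ_K[T^d]F_K) ≥ 0` with margin `0` in
188 of 936 `(A,B,n,d)` probes (8 bricks, `n ≤ 24`, odd `d ≤ A+5`) — the sharp clause is needed.
-/

namespace Summit.KontsevichZagierPeriods.Zeta5Search.BrickDenominatorsOddCTwo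

open Finset Nat WithZero
open Summit.KontsevichZagierPeriods.Zeta5Search.BrickLaurent (laurent cell)
open Summit.KontsevichZagierPeriods.Zeta5Search.BrickLaurentValuation (laurent_succ_succ)
open Summit.KontsevichZagierPeriods.Zeta5Search.BrickCellsAllPrimes (laurent_zero_valuation_abs)
open Summit.KontsevichZagierPeriods.Zeta5Search.BrickResidueLawTwo (padicValuation_two padicValuation_two_pow)
open Summit.KontsevichZagierPeriods.Zeta5Search.BrickPropositionHTwoSharpDepth (propositionH_two_sharp_linear_depth)
open Summit.KontsevichZagierPeriods.Zeta5Search.BrickPropositionHDepth (padicValuation_lcmUpto_pow_mul_sum_laurent_le)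
open Summit.KontsevichZagierPeriods.Zeta5Search.BrickDenominatorsTwo (padicValuation_lcmUpto_pow_mul theoreme1_r_one)
open Summit.KontsevichZagierPeriods.Zeta5Search.BrickDenominatorsOddC (two_mul_pZero_one_eq theoreme1_ii_odd_prime)
open Summit.KontsevichZagierPeriods.Zeta5Search.Zudilin2002IntegralityTwoAdic (exists_int_of_forall_padicValuation_le_one)
open Literature.NumberTheory.Irrationality.KrattenthalerRivoal2007 (IsPartialFractionData pCoeff pZero)

noncomputable section

/-! ## The centre factor, pole by pole, at depth -/

/-- **`Σ_K[T^{e+1}]F_K(n) = Σ_K[T^e]F̃_K(n) + ½·Σ_K(n − 2K)[T^{e+1}]F̃_K(n)`** (`t + n/2 = (t + K) + (n/2 − K)`, `laurent_succ_succ`). -/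
theorem sum_laurent_one_eq (A B n e : ℕ) :
    ∑ K ∈ range (n + 1), laurent A B 1 n K (e + 1) =
      ∑ K ∈ range (n + 1), laurent A B 0 n K e + 1 / 2 * ∑ K ∈ range (n + 1), ((n : ℚ) - 2 * K) * laurent A B 0 n K (e + 1) := by
  rw [Finset.mul_sum, ← Finset.sum_add_distrib]
  exact Finset.sum_congr rfl fun K _ => by rw [laurent_succ_succ]; ring

/-! ## At the prime `2` -/

section two

variable {A B : ℕ} (hA : Even A) (hB : 1 ≤ B) (hAB : 2 * B ≤ A)
include hA hB hAB

/-- **Level form at `2`**: for `n < 2^{ℓ+1}` and `e + 1` odd, `v₂(2^{ℓe}·Σ_K[T^{e+1}]F_K(n)) ≤ 1` — the unweighted half termwise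
(`laurent_zero_valuation_abs`), the moment `½Σ(n−2K)[T^{e+1}]F̃_K` by the SHARP clause at the odd depth `e + 1`. -/
theorem level_two_sum_laurent {ℓ n : ℕ} (hn : n < 2 ^ (ℓ + 1)) {e : ℕ} (he : Odd (e + 1)) :
    Rat.padicValuation 2 ((2 : ℚ) ^ (ℓ * e) * ∑ K ∈ range (n + 1), laurent A B 1 n K (e + 1)) ≤ 1 := by
  have htwo : (2 : ℚ) ^ (ℓ * (e + 1)) = (2 : ℚ) ^ (ℓ * e) * (2 : ℚ) ^ ℓ := by rw [← pow_add, Nat.mul_succ]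
  rw [sum_laurent_one_eq, mul_add]
  refine Valuation.map_add_le _ ?_ ?_
  · -- the unweighted part, termwise
    rw [Finset.mul_sum]
    refine Valuation.map_sum_le _ fun K hK => ?_
    have hK' : K ≤ n := by have := mem_range.1 hK; omega
    rw [map_mul, padicValuation_two_pow]
    calc _ ≤ exp (-((ℓ * e : ℕ) : ℤ)) * exp ((ℓ : ℤ) * e) :=
          mul_le_mul' le_rfl (laurent_zero_valuation_abs (p := 2) hAB hn hK' e)
      _ = 1 := by rw [← exp_add, ← exp_zero]; congr 1; push_cast; ring
  · -- the first antisymmetric moment: the sharp clause at depth `e + 1`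
    have hS := propositionH_two_sharp_linear_depth hA hB hAB ℓ n hn he
    set S := ∑ k ∈ range (n + 1), ((n : ℚ) - 2 * k) * ((2 : ℚ) ^ (ℓ * (e + 1)) * laurent A B 0 n k (e + 1)) with hSdef
    have hW : ∑ K ∈ range (n + 1), ((n : ℚ) - 2 * K) * laurent A B 0 n K (e + 1) = ((2 : ℚ) ^ (ℓ * (e + 1)))⁻¹ * S := by
      rw [hSdef, Finset.mul_sum]
      refine Finset.sum_congr rfl fun K _ => ?_
      rw [← mul_assoc, mul_comm (((2 : ℚ) ^ (ℓ * (e + 1)))⁻¹), mul_assoc, inv_mul_cancel_left₀ (pow_ne_zero _ two_ne_zero)]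
    rw [hW, htwo, mul_inv, one_div]
    rw [show (2 : ℚ) ^ (ℓ * e) * (2⁻¹ * (((2 : ℚ) ^ (ℓ * e))⁻¹ * ((2 : ℚ) ^ ℓ)⁻¹ * S)) = 2⁻¹ * (((2 : ℚ) ^ ℓ)⁻¹ * S) by
      field_simp]
    rw [map_mul, map_mul, map_inv₀, map_inv₀, padicValuation_two, padicValuation_two_pow, ← exp_neg, ← exp_neg, neg_neg, neg_neg]
    calc exp (1 : ℤ) * (exp (ℓ : ℤ) * Rat.padicValuation 2 S) ≤ exp (1 : ℤ) * (exp (ℓ : ℤ) * exp (-((ℓ : ℤ) + 1))) :=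
          mul_le_mul' le_rfl (mul_le_mul' le_rfl hS)
      _ = 1 := by rw [← exp_add, ← exp_add, ← exp_zero]; congr 1; ring

/-- **`v₂(d_n^{d−1}·Σ_{K≤n}[T^d]F_K(n)) ≤ 1` for every ODD depth `d`** (full kernel `(A,B,1)`, `A` even, `1 ≤ B ≤ A/2`; `d_n = lcm(1,…,n)`). -/
theorem padicValuation_lcmUpto_pow_mul_sum_laurent_two_le (n : ℕ) {d : ℕ} (hd : Odd d) :
    Rat.padicValuation 2 (((Nat.lcmUpto n : ℕ) : ℚ) ^ (d - 1) * ∑ K ∈ range (n + 1), laurent A B 1 n K d) ≤ 1 := by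
  obtain ⟨e, rfl⟩ : ∃ e, d = e + 1 := ⟨d - 1, by have := hd.pos; omega⟩
  rw [Nat.add_sub_cancel, padicValuation_lcmUpto_pow_mul]
  exact level_two_sum_laurent hA hB hAB (Nat.lt_pow_succ_log_self one_lt_two n) hd

/-- **`d_n^{d−1}·Σ_{K≤n}[T^d]F_K(n) ∈ ℤ` for every ODD depth `d`**, every `n` (full kernel `(A,B,1)`, `A` even, `1 ≤ B ≤ A/2`): odd primes
by PROPOSITION H^∞ at depth `d` (`BrickPropositionHDepth`), the prime `2` by the sharp clause.  At `d = A − l` (`l` odd) this is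
Krattenthaler–Rivoal's clause (i) `d_n^{A−l−1}p_{l,n}(1) ∈ ℤ`; at `d = A + C` (`C` odd) it is their clause (ii) (`theoreme1_ii_odd_C`). -/
theorem lcmUpto_pow_mul_sum_laurent_isInt (n : ℕ) {d : ℕ} (hd : Odd d) :
    ∃ z : ℤ, ((Nat.lcmUpto n : ℕ) : ℚ) ^ (d - 1) * ∑ K ∈ range (n + 1), laurent A B 1 n K d = z := by
  refine exists_int_of_forall_padicValuation_le_one fun p hp => ?_
  by_cases hp2 : p = 2
  · subst hp2; exact padicValuation_lcmUpto_pow_mul_sum_laurent_two_le hA hB hAB n hd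
  · exact @padicValuation_lcmUpto_pow_mul_sum_laurent_le p ⟨hp⟩ hp2 A B hA hB hAB n d (by have := hd.pos; omega)

/-! ## Krattenthaler–Rivoal's Théorème 1 (ii) for odd `C` -/

/-- **Théorème 1 (ii) (`r = 1`, `A` even, `C` odd) AT THE PRIME `2`**: `v₂(2·d_n^{A+C−1}·p_{0,C,n}((−1)^A)) ≤ 1` for all data `c` of
`R_{n,A,B,1}` — the printed `2` is absorbed by the identity `2·p_{0,C,n}(1) = −Σ_m[T^{A+C}]F_m`. -/
theorem theoreme1_ii_two {C : ℕ} (hC : Odd C) {n : ℕ} {c : ℕ → ℕ → ℚ} (hc : IsPartialFractionData n A B 1 c) :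
    Rat.padicValuation 2 (2 * ((Nat.lcmUpto n : ℕ) : ℚ) ^ (A + C - 1) * pZero n A C c ((-1) ^ A)) ≤ 1 := by
  rw [hA.neg_one_pow, mul_assoc, mul_left_comm, two_mul_pZero_one_eq hA hAB (by omega) hC hc, mul_neg, Valuation.map_neg]
  exact padicValuation_lcmUpto_pow_mul_sum_laurent_two_le hA hB hAB n (hA.add_odd hC)

/-- **KRATTENTHALER–RIVOAL 2007, THÉORÈME 1 (ii), for `r = 1`, `A` even, `1 ≤ B`, `2B ≤ A`, ODD `C` — exactly as printed, as a
theorem of the tree**: for every `n` and all partial-fraction data `c` of `R_{n,A,B,1}`: `2·d_n^{A+C−1}·p_{0,C,n}((−1)^A) ∈ ℤ`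
(`d_n = lcm(1,…,n)`).  Odd primes: `BrickDenominatorsOddC.theoreme1_ii_odd_prime`; the prime `2`: `theoreme1_ii_two`.  PROOF ROUTE ≠
PRINT (Andrews's multisum identity, KR §5): `2p_{0,C,n}(1) = −Σ_m[T^{A+C}]F_m` and the cell's digit induction at depth `A + C`.
[Krattenthaler–Rivoal, Mem. AMS 186 (2007) no. 875, §3 Théorème 1 (ii); arXiv:math/0311114 p. 8] -/
theorem theoreme1_ii_odd_C {C : ℕ} (hC : Odd C) {n : ℕ} {c : ℕ → ℕ → ℚ} (hc : IsPartialFractionData n A B 1 c) :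
    ∃ z : ℤ, 2 * ((Nat.lcmUpto n : ℕ) : ℚ) ^ (A + C - 1) * pZero n A C c ((-1) ^ A) = z := by
  refine exists_int_of_forall_padicValuation_le_one fun p hp => ?_
  by_cases hp2 : p = 2
  · subst hp2; exact theoreme1_ii_two hA hB hAB hC hc
  · exact @theoreme1_ii_odd_prime p ⟨hp⟩ hp2 A B hA hB hAB C hC n c hc

/-- **Théorème 1 for `r = 1`, `A` even, `1 ≤ B`, `2B ≤ A`, ODD `C`, both clauses**: (i) `d_n^{A−l−1}·p_{l,n}((−1)^A) ∈ ℤ` for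
`1 ≤ l ≤ A − 1` (`C`-free; ct-1 g44's `BrickDenominatorsTwo.theoreme1_r_one`) and (ii) `2·d_n^{A+C−1}·p_{0,C,n}((−1)^A) ∈ ℤ` — the body
of the named fact `KrattenthalerRivoal2007.theoreme1` at `r = 1` under `Even A`, `Odd C` (the fact itself is NOT discharged). -/
theorem theoreme1_r_one_odd_C {C : ℕ} (hC : Odd C) {n : ℕ} {c : ℕ → ℕ → ℚ} (hc : IsPartialFractionData n A B 1 c) :
    (∀ l : ℕ, 1 ≤ l → l + 1 ≤ A →
        ∃ z : ℤ, ((Nat.lcmUpto n : ℕ) : ℚ) ^ (A - l - 1) * pCoeff n c l ((-1) ^ A) = z) ∧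
      ∃ z : ℤ, 2 * ((Nat.lcmUpto n : ℕ) : ℚ) ^ (A + C - 1) * pZero n A C c ((-1) ^ A) = z :=
  ⟨(theoreme1_r_one hA hB hAB hc).1, theoreme1_ii_odd_C hA hB hAB hC hc⟩

end two

end

end Summit.KontsevichZagierPeriods.Zeta5Search.BrickDenominatorsOddCTwo
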